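import Mathlib
import Literature.MathematicalPhysics.MHD.StellaratorAverageCurvature
import Literature.MathematicalPhysics.MHD.StellaratorShearVerticalField
import HarnessLib

/-!
# The loose-helix limit of the exact average curvature (12.249): for every `l ≥ 1`,
# `κ̄(u) ≈ −2l²(l−1)α_l²Δ² u^{2l−2}`, `α_l = 1/(2^l l!)` — which IS the printed `−2(l−1)δ²(r/a)^{2(l−1)}`
# (Freidberg 2014 §12.12.4, eq. (12.249) and its first approximation) — PROVED as a limit theorem

Topic `Literature/MathematicalPhysics/MHD` (namespace = path; sub-namespace `Stellarator`).  A CONSISTENCY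
bridge inside the stellarator lane: the EXACT renormalised average curvature
`κ̄(u) = −(Δ²/2) u d/du[(I_l′)² + (1 + l²/u²)I_l²]` (12.249) (`helixAvgCurvature`,
`StellaratorAverageCurvature.lean`) against the book's loose-helix evaluation («for a loosely wound
helix … `κ̄(r) ≈ −2(l−1)δ²(r/a)^{2(l−1)}`, `l ≥ 2`», obtained from the small-argument expansion
(12.247)/(6.207) of `I_l`), and — at `l = 2` — against the closed form `κ̄ = −2δ²(r/a)²` of
(12.257)/(12.265) (`looseHelixKappa`, `StellaratorShearVerticalField.lean`).

## What is proved (no named facts)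
* `helixPhi_eq_besselI_succ`: `Φ_l = (u² + l² − l)(2l I_l² + 2u I_l I_{l+1}) − u² I_{l+1}²`
  (`uI_l′ = lI_l + uI_{l+1}`, DLMF 10.29.2).
* series bounds on `0 ≤ u ≤ 1` (DLMF 10.25.2 via the tree): `α_l u^l ≤ I_l(u) ≤ α_l u^l (1 + u²/2)`,
  `α_l = 1/(2^l l!)` (`alphaCoeff`); hence the squeeze `u^{2l} L_l(u) ≤ Φ_l(u) ≤ u^{2l} U_l(u)` with explicit
  `L_l, U_l`, `L_l(0) = U_l(0) = 2l²(l−1)α_l²`.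
* ★ `tendsto_helixPhi_div_pow`: `Φ_l(u)/u^{2l} → 2l²(l−1)α_l²` (every `l`);
  ★ `tendsto_helixAvgCurvature_div_pow`: `κ̄(u)/u^{2l−2} → −2l²(l−1)α_l²Δ²` as `u = hr → 0⁺` (`l ≥ 1`).
* `looseHelix_identity`: with the loose-helix amplitude `Δ₀ = haδ/(l α_l (ha)^l)` (i.e. (12.244) with
  `(l² + h²a²)^{1/2} → l`, `I_l(ha) → α_l(ha)^l`), `−2l²(l−1)α_l²Δ₀²(hr)^{2l−2} = −2(l−1)δ²(r/a)^{2(l−1)}`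
  EXACTLY — the printed first approximation of (12.249); at `l = 2`: `Φ₂/u⁴ → 1/8`, `κ̄/u² → −Δ²/8`, and
  `looseHelixKappa a δ r = −(Δ₀²/8)(hr)²` with `Δ₀ = 4δ/(ha)` (`looseHelixKappa_eq_limitLaw`).
  (At `l = 1` the limit constant is `0`: the printed `l = 1` form `−h²a²δ²(r/a)²` is the NEXT order and is
  not typed; likewise `l = 0`.)

## Three columns (GRIDFUSION)
CERTIFIED = the limit law of the exact (12.249) for every `l ≥ 1` and its identity with the printed
loose-helix forms.  VALIDATED = nothing.  MODELLED = as in the parent files (straight vacuum helix to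
`O(δ²)`); the loose helix `ha ≪ 1` enters only through `Δ ≈ Δ₀` (that approximation of `Δ` is not typed).

## Sources, as printed (read on the page, 2026-08-27)
* J. P. Freidberg, *Ideal MHD*, CUP 2014 [Freidberg2014]: §12.12.4 eqs. (12.244), (12.247)–(12.249)
  [galaxy:panama:388488381857833 p0533–p0534]; §12.12.5 (12.257), §12.12.6 (12.265) [p0535, p0537];
  §6.7.4 (6.207) [p0171].  [DLMF] 10.25.2, 10.29.2 via the tree's `BesselIKRealAxis.lean`.
Typer/prover: gridfusion-lit-3 (g8), 2026-08-27.
-/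

noncomputable section

namespace Literature.MathematicalPhysics.MHD

namespace Stellarator

open _root_.Real _root_.Set _root_.Filter _root_.Topology
open Literature.Analysis.FunctionSpaces

/-! ## §1 `Φ_l` through `I_l, I_{l+1}` and the series bounds -/

/-- `Φ_l = (u² + l² − l)(2l I_l² + 2u I_l I_{l+1}) − u² I_{l+1}²`, from `uI_l′ = lI_l + uI_{l+1}`.
[cite: DLMF, 10.29.2] -/
theorem helixPhi_eq_besselI_succ (l : ℕ) (u : ℝ) :
    helixPhi l u = (u ^ 2 + (l : ℝ) ^ 2 - l) * (2 * l * besselI l u ^ 2 + 2 * u * besselI l u * besselI (l + 1) u)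
      - u ^ 2 * besselI (l + 1) u ^ 2 := by
  have hB : u * deriv (besselI l) u = l * besselI l u + u * besselI (l + 1) u := mul_deriv_besselI l u
  unfold helixPhi
  rw [hB]
  ring

/-- The leading small-argument coefficient `α_l = 1/(2^l l!)` of `I_l(u) ≈ α_l u^l` (6.207)/(12.247).
[cite: Freidberg2014, §6.7.4 eq. (6.207)] -/
def alphaCoeff (l : ℕ) : ℝ := 1 / (2 ^ l * (l.factorial : ℝ))

/-- `α_l > 0`. [cite: Freidberg2014, §6.7.4 eq. (6.207)] -/
theorem alphaCoeff_pos (l : ℕ) : 0 < alphaCoeff l := by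
  unfold alphaCoeff; positivity

/-- `(u/2)^l/l! = α_l u^l`. [cite: DLMF, 10.25.2] -/
theorem firstTerm_eq (l : ℕ) (u : ℝ) : (u / 2) ^ l / (l.factorial : ℝ) = alphaCoeff l * u ^ l := by
  unfold alphaCoeff
  rw [div_pow]
  field_simp

/-- Lower series bound `α_l u^l ≤ I_l(u)` for `u ≥ 0`. [cite: DLMF, 10.25.2] -/
theorem alpha_pow_le_besselI (l : ℕ) {u : ℝ} (hu : 0 ≤ u) : alphaCoeff l * u ^ l ≤ besselI l u := by
  have h := firstTwoTerms_le_besselI l hu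
  rw [firstTerm_eq] at h
  have h1 : alphaCoeff l * u ^ l ≤ alphaCoeff l * u ^ l * (1 + u ^ 2 / (4 * (l + 1))) := by
    have hc : 0 ≤ alphaCoeff l * u ^ l := by have := alphaCoeff_pos l; positivity
    have : (1 : ℝ) ≤ 1 + u ^ 2 / (4 * (l + 1)) := by
      have : 0 ≤ u ^ 2 / (4 * ((l : ℝ) + 1)) := by positivity
      linarith
    nlinarith
  exact h1.trans h

/-- Upper series bound `I_l(u) ≤ α_l u^l (1 + u²/2)` for `0 ≤ u ≤ 1` (geometric majorant with ratio
`u²/(4(l+1)) ≤ 1/4`). [cite: DLMF, 10.25.2] -/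
theorem besselI_le_alpha_pow (l : ℕ) {u : ℝ} (hu0 : 0 ≤ u) (hu1 : u ≤ 1) :
    besselI l u ≤ alphaCoeff l * u ^ l * (1 + u ^ 2 / 2) := by
  have hl : (0 : ℝ) ≤ l := Nat.cast_nonneg l
  have hρ : u ^ 2 < 4 * ((l : ℝ) + 1) := by nlinarith
  have h := besselI_le_firstTerm_div l hu0 hρ
  rw [firstTerm_eq] at h
  set x : ℝ := u ^ 2 / (4 * ((l : ℝ) + 1)) with hx
  have hx0 : 0 ≤ x := by positivity
  have hxle : x ≤ u ^ 2 / 4 := by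
    rw [hx]; apply div_le_div_of_nonneg_left (sq_nonneg u) (by norm_num); nlinarith
  have hx1 : x < 1 := by nlinarith
  have hinv : (1 - x)⁻¹ ≤ 1 + u ^ 2 / 2 := by
    rw [inv_le_comm₀ (by linarith) (by positivity)]
    -- `(1 + u²/2)⁻¹ ≤ 1 − x` ⇐ `(1 − x)(1 + u²/2) ≥ 1`
    rw [inv_le_iff_one_le_mul₀ (by positivity)]
    have h1 : x * (u ^ 2 / 2) ≤ u ^ 2 / 4 * (u ^ 2 / 2) :=
      mul_le_mul_of_nonneg_right hxle (by positivity)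
    have h2 : u ^ 2 * u ^ 2 ≤ u ^ 2 := by
      have hu2 : u ^ 2 ≤ 1 := by nlinarith
      nlinarith [sq_nonneg u]
    nlinarith
  have hc : 0 ≤ alphaCoeff l * u ^ l := by have := alphaCoeff_pos l; positivity
  calc besselI l u ≤ alphaCoeff l * u ^ l * (1 - x)⁻¹ := h
    _ ≤ alphaCoeff l * u ^ l * (1 + u ^ 2 / 2) := mul_le_mul_of_nonneg_left hinv hc

/-! ## §2 The squeeze and the limit laws -/

/-- Lower squeeze function: `L_l(u) = 2l(u² + l² − l)α_l² − u⁴ α_{l+1}²(1 + u²/2)²`,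
`L_l(0) = 2l²(l−1)α_l²`. [cite: Freidberg2014, §12.12.4 eq. (12.249)] -/
def phiLowerGen (l : ℕ) (u : ℝ) : ℝ :=
  2 * l * (u ^ 2 + (l : ℝ) ^ 2 - l) * alphaCoeff l ^ 2
    - u ^ 4 * alphaCoeff (l + 1) ^ 2 * (1 + u ^ 2 / 2) ^ 2

/-- Upper squeeze function:
`U_l(u) = (u² + l² − l)(2l α_l²(1 + u²/2)² + 2 α_l α_{l+1} (1 + u²/2)² u²)`, `U_l(0) = 2l²(l−1)α_l²`.
[cite: Freidberg2014, §12.12.4 eq. (12.249)] -/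
def phiUpperGen (l : ℕ) (u : ℝ) : ℝ :=
  (u ^ 2 + (l : ℝ) ^ 2 - l)
    * (2 * l * alphaCoeff l ^ 2 * (1 + u ^ 2 / 2) ^ 2
        + 2 * alphaCoeff l * alphaCoeff (l + 1) * (1 + u ^ 2 / 2) ^ 2 * u ^ 2)

/-- The squeeze `u^{2l} L_l(u) ≤ Φ_l(u) ≤ u^{2l} U_l(u)` on `0 ≤ u ≤ 1`, every `l`.
[cite: Freidberg2014, §12.12.4 eqs. (12.247)–(12.249)] -/
theorem helixPhi_squeeze (l : ℕ) {u : ℝ} (hu0 : 0 ≤ u) (hu1 : u ≤ 1) :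
    u ^ (2 * l) * phiLowerGen l u ≤ helixPhi l u ∧ helixPhi l u ≤ u ^ (2 * l) * phiUpperGen l u := by
  rw [helixPhi_eq_besselI_succ]
  set A := besselI l u with hA
  set D := besselI (l + 1) u with hD
  have hαl := alphaCoeff_pos l
  have hαl1 := alphaCoeff_pos (l + 1)
  have hAlo : alphaCoeff l * u ^ l ≤ A := alpha_pow_le_besselI l hu0
  have hAhi : A ≤ alphaCoeff l * u ^ l * (1 + u ^ 2 / 2) := besselI_le_alpha_pow l hu0 hu1
  have hDlo : 0 ≤ D := le_trans (by positivity) (alpha_pow_le_besselI (l + 1) hu0)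
  have hDhi : D ≤ alphaCoeff (l + 1) * u ^ (l + 1) * (1 + u ^ 2 / 2) := besselI_le_alpha_pow (l + 1) hu0 hu1
  have hA0 : 0 ≤ A := le_trans (by positivity) hAlo
  have hl0 : (0 : ℝ) ≤ l := Nat.cast_nonneg l
  have hcoef : 0 ≤ u ^ 2 + (l : ℝ) ^ 2 - l := by
    have : (l : ℝ) ≤ (l : ℝ) ^ 2 := by
      rcases Nat.eq_zero_or_pos l with h0 | hpos
      · simp [h0]
      · have : (1 : ℝ) ≤ l := by exact_mod_cast hpos
        nlinarith
    nlinarith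
  have e2l : u ^ (2 * l) = (u ^ l) ^ 2 := by rw [← pow_mul, mul_comm]
  constructor
  · -- lower: keep `2lA²` (≥ 2l α² u^{2l}), drop `2uAD ≥ 0`, bound `u²D²` above
    have h1 : 2 * l * (alphaCoeff l * u ^ l) ^ 2 ≤ 2 * l * A ^ 2 :=
      mul_le_mul_of_nonneg_left (pow_le_pow_left₀ (by positivity) hAlo 2) (by positivity)
    have h2 : 0 ≤ 2 * u * A * D := by positivity
    have h3 : u ^ 2 * D ^ 2 ≤ u ^ 2 * (alphaCoeff (l + 1) * u ^ (l + 1) * (1 + u ^ 2 / 2)) ^ 2 :=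
      mul_le_mul_of_nonneg_left (pow_le_pow_left₀ hDlo hDhi 2) (by positivity)
    have h4 : (u ^ 2 + (l : ℝ) ^ 2 - l) * (2 * l * (alphaCoeff l * u ^ l) ^ 2)
        ≤ (u ^ 2 + (l : ℝ) ^ 2 - l) * (2 * l * A ^ 2 + 2 * u * A * D) :=
      mul_le_mul_of_nonneg_left (by linarith) hcoef
    have e : u ^ (2 * l) * phiLowerGen l u
        = (u ^ 2 + (l : ℝ) ^ 2 - l) * (2 * l * (alphaCoeff l * u ^ l) ^ 2)
          - u ^ 2 * (alphaCoeff (l + 1) * u ^ (l + 1) * (1 + u ^ 2 / 2)) ^ 2 := by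
      unfold phiLowerGen; rw [e2l]; ring
    rw [e]
    linarith
  · -- upper: monotone in `A`; drop `−u²D²`; bound the cross term with the upper bounds
    have h1 : 2 * l * A ^ 2 ≤ 2 * l * (alphaCoeff l * u ^ l * (1 + u ^ 2 / 2)) ^ 2 :=
      mul_le_mul_of_nonneg_left (pow_le_pow_left₀ hA0 hAhi 2) (by positivity)
    have h2 : 2 * u * A * D
        ≤ 2 * u * (alphaCoeff l * u ^ l * (1 + u ^ 2 / 2)) * (alphaCoeff (l + 1) * u ^ (l + 1) * (1 + u ^ 2 / 2)) := by
      have hAD := mul_le_mul hAhi hDhi hDlo (by positivity)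
      have hc : 0 ≤ 2 * u := by positivity
      calc 2 * u * A * D = 2 * u * (A * D) := by ring
        _ ≤ 2 * u * ((alphaCoeff l * u ^ l * (1 + u ^ 2 / 2))
              * (alphaCoeff (l + 1) * u ^ (l + 1) * (1 + u ^ 2 / 2))) := mul_le_mul_of_nonneg_left hAD hc
        _ = _ := by ring
    have h3 : 0 ≤ u ^ 2 * D ^ 2 := by positivity
    have h4 : (u ^ 2 + (l : ℝ) ^ 2 - l) * (2 * l * A ^ 2 + 2 * u * A * D)
        ≤ (u ^ 2 + (l : ℝ) ^ 2 - l) * (2 * l * (alphaCoeff l * u ^ l * (1 + u ^ 2 / 2)) ^ 2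
          + 2 * u * (alphaCoeff l * u ^ l * (1 + u ^ 2 / 2))
              * (alphaCoeff (l + 1) * u ^ (l + 1) * (1 + u ^ 2 / 2))) :=
      mul_le_mul_of_nonneg_left (by linarith) hcoef
    have e : u ^ (2 * l) * phiUpperGen l u
        = (u ^ 2 + (l : ℝ) ^ 2 - l) * (2 * l * (alphaCoeff l * u ^ l * (1 + u ^ 2 / 2)) ^ 2
          + 2 * u * (alphaCoeff l * u ^ l * (1 + u ^ 2 / 2))
              * (alphaCoeff (l + 1) * u ^ (l + 1) * (1 + u ^ 2 / 2))) := by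
      unfold phiUpperGen; rw [e2l]; ring
    rw [e]
    linarith

/-- ★ THE LIMIT LAW of the exact `Φ_l`: `Φ_l(u)/u^{2l} → 2l²(l−1)α_l²` as `u → 0⁺` (every `l ∈ ℕ`; the
constant vanishes for `l = 0, 1`). [cite: Freidberg2014, §12.12.4 eqs. (12.247)–(12.249)] -/
theorem tendsto_helixPhi_div_pow (l : ℕ) :
    Tendsto (fun u => helixPhi l u / u ^ (2 * l)) (𝓝[>] 0)
      (𝓝 (2 * (l : ℝ) ^ 2 * ((l : ℝ) - 1) * alphaCoeff l ^ 2)) := by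
  have hval : 2 * (l : ℝ) * ((0 : ℝ) ^ 2 + (l : ℝ) ^ 2 - l) * alphaCoeff l ^ 2
      = 2 * (l : ℝ) ^ 2 * ((l : ℝ) - 1) * alphaCoeff l ^ 2 := by ring
  have hL : Tendsto (phiLowerGen l) (𝓝[>] 0) (𝓝 (2 * (l : ℝ) ^ 2 * ((l : ℝ) - 1) * alphaCoeff l ^ 2)) := by
    have hc : Continuous (phiLowerGen l) := by unfold phiLowerGen; fun_prop
    have := hc.tendsto 0
    have e : phiLowerGen l 0 = 2 * (l : ℝ) ^ 2 * ((l : ℝ) - 1) * alphaCoeff l ^ 2 := by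
      unfold phiLowerGen; ring
    rw [e] at this
    exact this.mono_left nhdsWithin_le_nhds
  have hU : Tendsto (phiUpperGen l) (𝓝[>] 0) (𝓝 (2 * (l : ℝ) ^ 2 * ((l : ℝ) - 1) * alphaCoeff l ^ 2)) := by
    have hc : Continuous (phiUpperGen l) := by unfold phiUpperGen; fun_prop
    have := hc.tendsto 0
    have e : phiUpperGen l 0 = 2 * (l : ℝ) ^ 2 * ((l : ℝ) - 1) * alphaCoeff l ^ 2 := by
      unfold phiUpperGen; ring
    rw [e] at this
    exact this.mono_left nhdsWithin_le_nhds
  refine tendsto_of_tendsto_of_tendsto_of_le_of_le' hL hU ?_ ?_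
  · filter_upwards [Ioo_mem_nhdsGT (zero_lt_one' ℝ)] with u hu
    have hup : 0 < u ^ (2 * l) := pow_pos hu.1 _
    rw [le_div_iff₀ hup, mul_comm]
    exact (helixPhi_squeeze l hu.1.le hu.2.le).1
  · filter_upwards [Ioo_mem_nhdsGT (zero_lt_one' ℝ)] with u hu
    have hup : 0 < u ^ (2 * l) := pow_pos hu.1 _
    rw [div_le_iff₀ hup, mul_comm]
    exact (helixPhi_squeeze l hu.1.le hu.2.le).2

/-- ★ THE LOOSE-HELIX LIMIT LAW of the exact average curvature (12.249): for `l ≥ 1`,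
`κ̄(u)/u^{2l−2} → −2l²(l−1)α_l²Δ²` as `u = hr → 0⁺` (`κ̄ = −(Δ²/2)u·(bracket)′ = −Δ²Φ_l/u²`).
[cite: Freidberg2014, §12.12.4 eq. (12.249)] -/
theorem tendsto_helixAvgCurvature_div_pow {l : ℕ} (hl : 1 ≤ l) (Δ : ℝ) :
    Tendsto (fun u => helixAvgCurvature l Δ u / u ^ (2 * l - 2)) (𝓝[>] 0)
      (𝓝 (-(2 * (l : ℝ) ^ 2 * ((l : ℝ) - 1) * alphaCoeff l ^ 2 * Δ ^ 2))) := by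
  have h := (tendsto_helixPhi_div_pow l).const_mul (-(Δ ^ 2))
  have e : -(Δ ^ 2) * (2 * (l : ℝ) ^ 2 * ((l : ℝ) - 1) * alphaCoeff l ^ 2)
      = -(2 * (l : ℝ) ^ 2 * ((l : ℝ) - 1) * alphaCoeff l ^ 2 * Δ ^ 2) := by ring
  rw [e] at h
  refine h.congr' ?_
  filter_upwards [self_mem_nhdsWithin] with u hu
  have hu0 : (u : ℝ) ≠ 0 := ne_of_gt hu
  unfold helixAvgCurvature
  rw [deriv_helixBracket l hu0]
  have e2 : u ^ (2 * l) = u ^ (2 * l - 2) * u ^ 2 := by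
    rw [← pow_add]; congr 1; omega
  rw [e2]
  field_simp

/-! ## §3 The printed loose-helix forms -/

/-- The loose-helix value of the amplitude (12.244): `Δ₀ = haδ/(l α_l (ha)^l)` — (12.244) with
`(l² + h²a²)^{1/2} → l` and `I_l(ha) → α_l (ha)^l`. [cite: Freidberg2014, §12.12.4 eq. (12.244)] -/
def looseHelixDelta (l : ℕ) (h a δ : ℝ) : ℝ := h * a * δ / (l * alphaCoeff l * (h * a) ^ l)

/-- ★ The printed first approximation of (12.249) is EXACTLY the limit law evaluated at `Δ₀`:
`−2l²(l−1)α_l²Δ₀²·(hr)^{2l−2} = −2(l−1)δ²(r/a)^{2(l−1)}` (`l ≥ 1`, `h, a ≠ 0`).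
[cite: Freidberg2014, §12.12.4 eq. (12.249)] -/
theorem looseHelix_identity {l : ℕ} (hl : 1 ≤ l) {h a : ℝ} (hh : h ≠ 0) (ha : a ≠ 0) (δ r : ℝ) :
    -(2 * (l : ℝ) ^ 2 * ((l : ℝ) - 1) * alphaCoeff l ^ 2 * looseHelixDelta l h a δ ^ 2) * (h * r) ^ (2 * l - 2)
      = -2 * ((l : ℝ) - 1) * δ ^ 2 * (r / a) ^ (2 * (l - 1)) := by
  have hl1 : (1 : ℝ) ≤ l := by exact_mod_cast hl
  have hl0 : (l : ℝ) ≠ 0 := by linarith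
  have hα := (alphaCoeff_pos l).ne'
  obtain ⟨n, hn⟩ : ∃ n : ℕ, 2 * l - 2 = n := ⟨_, rfl⟩
  have h2l : l * 2 = n + 2 := by omega
  have e1 : 2 * (l - 1) = n := by omega
  rw [e1, hn]
  have hD : looseHelixDelta l h a δ ^ 2
      = h ^ 2 * a ^ 2 * δ ^ 2 / ((l : ℝ) ^ 2 * alphaCoeff l ^ 2 * ((h * a) ^ l) ^ 2) := by
    unfold looseHelixDelta
    rw [div_pow]
    ring
  have epow : ((h * a) ^ l) ^ 2 = h ^ n * a ^ n * (h ^ 2 * a ^ 2) := by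
    rw [← pow_mul, h2l, pow_add, mul_pow, mul_pow]
  rw [hD, epow, mul_pow, div_pow]
  have hhn : h ^ n ≠ 0 := pow_ne_zero n hh
  have han : a ^ n ≠ 0 := pow_ne_zero n ha
  field_simp

end Stellarator

end Literature.MathematicalPhysics.MHD
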